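import Literature.AlgebraicGeometry.Motives.StratumSubmersionCharts
import Literature.AlgebraicGeometry.Motives.ComplexPointsSubmersion
import Mathlib.Analysis.Calculus.InverseFunctionTheorem.ContDiff
import Mathlib.Analysis.Normed.Ring.Units
import Mathlib.LinearAlgebra.Projection
import HarnessLib

/-!
# Adapted charts of `X(ℂ)`: a morphism as a projection and boundary divisors as coordinate subspaces

Topic `Literature/AlgebraicGeometry/Motives`. The analytic packaging of *adapted coordinates* for a
family with a normal crossings boundary (Voisin I §9.1.1; Dimca 1992 Ch. 1 (3.1): Ehresmann's
theorem relative to closed submanifolds meeting the fibres transversally). Let `g : X ⟶ Y` be a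
morphism of `ℂ`-schemes smooth over `ℂ` and locally of finite type (so that `X(ℂ)`, `Y(ℂ)` are real
`C^∞` manifolds of dimensions `2n`, `2m` through their algebraic charts,
`ComplexPoints.chartedSpace`), `P ∈ X(ℂ)`, and `w₁, …, w_r ∈ Γ(X, U₀)` regular functions on an
affine open `U₀ ∋ P` which

* vanish on an affine `X`-scheme `ι : Z → X` ("the stratum through `P`") carrying a complex point
  `P'` over `P` at which `Z → Y` is smooth, and
* have germs at `P` linearly independent modulo `𝔪_P²`,

and let `S_j ⊆ X` be finitely many closed subsets each of which either misses `P` or is cut out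
on `U₀` by one of the `wᵢ`. Then (`exists_adaptedChart`) there is an open partial homeomorphism
`φ : X(ℂ) ⇀ ℝ²ᵐ × ℂⁿ⁻ᵐ` at `P`, `C^∞` with `C^∞` inverse, with source over the chart domain of
`Y(ℂ)` at `g(P)`, whose FIRST COMPONENT IS `extChartAt (g P) ∘ g(ℂ)`, and in which every
`S_j(ℂ)` is empty or the preimage of `ℝ²ᵐ × L_j` for a real linear subspace `L_j ⊆ ℂⁿ⁻ᵐ` — exactly
the hypothesis `hchart` of the relative Ehresmann theorem
`Literature.AlgebraicTopology.Homotopy.isLocallyTrivialFibration_compl_of_straightened`. Proof: the map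
`(g, w)` is a submersion at `P` in algebraic charts (`surjective_fderiv_chart_map_prod`); complete
its differential by a projection onto the kernel, straighten the resulting holomorphic map by the
real inverse function theorem (restricted to where the derivative stays invertible, so that the
inverse is `C^∞` on the whole target), and fix the dimension of the fibre factor by a linear
isomorphism `ℂʳ × ker ≅ ℂⁿ⁻ᵐ`.

Everything is proved; no named facts.

## References

* C. Voisin, *Hodge Theory and Complex Algebraic Geometry I* (2002), §9.1.1. [VoisinHodgeI2002]
* A. Dimca, *Singularities and Topology of Hypersurfaces* (1992), Ch. 1, Prop. (3.1), Thm. (3.5). [Dimca1992]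
* J.-P. Serre, GAGA, Ann. Inst. Fourier 6 (1956), §2 n°5 Prop. 2. [SerreGAGA1956]
-/

noncomputable section

open CategoryTheory AlgebraicGeometry Filter Topology Set
open scoped ContDiff Manifold
open Literature.AlgebraicGeometry.Motives.AlgPoints (evalOrZero evalOrZero_of_mem evalOrZero_of_not_mem)
open Literature.AlgebraicGeometry.HodgeTheory.GAGADimension

namespace Literature.AlgebraicGeometry.Motives

/-! ### The inverse function theorem, packaged -/

/-- **Inverse function theorem, packaged** (a private copy of the tree's
`Topology.FourManifolds.exists_openPartialHomeomorph_contDiffOn_symm`, to keep the imports light): a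
map `Cᵐ` (`m ≥ 1`) on an open `O ∋ y₀` of a complete normed space with invertible derivative at
`y₀` restricts to an open partial homeomorphism `G = Θ` with `y₀ ∈ G.source ⊆ O`, `Cᵐ` with `Cᵐ`
inverse on the whole target (restrict to where the derivative stays invertible). [folklore] -/
private theorem exists_openPartialHomeomorph_contDiffOn_symm' {E F : Type*} [NormedAddCommGroup E]
    [NormedSpace ℝ E] [CompleteSpace E] [NormedAddCommGroup F] [NormedSpace ℝ F]
    {Θ : E → F} {O : Set E} (hO : IsOpen O) {y₀ : E} (hy₀ : y₀ ∈ O) {m : WithTop ℕ∞}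
    (hm : 1 ≤ m) (hΘ : ContDiffOn ℝ m Θ O) (T : E ≃L[ℝ] F)
    (hT : HasFDerivAt Θ (T : E →L[ℝ] F) y₀) :
    ∃ G : OpenPartialHomeomorph E F, ⇑G = Θ ∧ y₀ ∈ G.source ∧ G.source ⊆ O ∧
      ContDiffOn ℝ m G G.source ∧ ContDiffOn ℝ m G.symm G.target := by
  have hm0 : m ≠ 0 := by
    rintro rfl
    exact not_lt.2 hm zero_lt_one
  set A : E → E →L[ℝ] E := fun e => (T.symm : F →L[ℝ] E).comp (fderiv ℝ Θ e) with hA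
  have hAcont : ContinuousOn A O :=
    continuousOn_const.clm_comp (hΘ.continuousOn_fderiv_of_isOpen hO hm)
  set O' : Set E := O ∩ A ⁻¹' {u | IsUnit u} with hO'
  have hO'open : IsOpen O' := hAcont.isOpen_inter_preimage hO Units.isOpen
  have hAy : A y₀ = 1 := by
    rw [hA]
    dsimp only
    rw [hT.fderiv]
    ext v
    simp
  have hyO' : y₀ ∈ O' := ⟨hy₀, by rw [mem_preimage, mem_setOf_eq, hAy]; exact isUnit_one⟩
  have hΘAt : ∀ e ∈ O', ContDiffAt ℝ m Θ e := fun e he => hΘ.contDiffAt (hO.mem_nhds he.1)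
  have hderiv : ∀ e ∈ O', ∃ Te : E ≃L[ℝ] F, HasFDerivAt Θ (Te : E →L[ℝ] F) e := by
    intro e he
    have hunit : IsUnit (A e) := he.2
    refine ⟨(ContinuousLinearEquiv.unitsEquiv ℝ E hunit.unit).trans T, ?_⟩
    have hd : HasFDerivAt Θ (fderiv ℝ Θ e) e := ((hΘAt e he).differentiableAt hm0).hasFDerivAt
    convert hd using 1
    ext v
    simp [hA]
  set G : OpenPartialHomeomorph E F :=
    ((hΘAt _ hyO').toOpenPartialHomeomorph Θ hT hm0).restrOpen O' hO'open with hGdef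
  have hGsource : G.source ⊆ O' := fun e he => he.2
  refine ⟨G, rfl, ⟨(hΘAt _ hyO').mem_toOpenPartialHomeomorph_source hT hm0, hyO'⟩,
    fun e he => (hGsource he).1, hΘ.mono fun e he => (hGsource he).1, ?_⟩
  intro b hb
  have hb' : G.symm b ∈ O' := hGsource (G.map_target hb)
  obtain ⟨Te, hTe⟩ := hderiv _ hb'
  exact (G.contDiffAt_symm hb hTe (hΘAt _ hb')).contDiffWithinAt

/-! ### Linear algebra: completing a surjection by a projection onto its kernel -/

/-- **Completing a surjective linear map to an isomorphism**: for `T : V → W` onto (finite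
dimension) there is a linear isomorphism `J : V ≃ W × ker T` with first component `T`. [folklore] -/
theorem exists_linearEquiv_prod_ker_fst_eq {V W : Type*} [AddCommGroup V] [Module ℂ V]
    [FiniteDimensional ℂ V] [AddCommGroup W] [Module ℂ W] (T : V →ₗ[ℂ] W)
    (hT : Function.Surjective T) :
    ∃ J : V ≃ₗ[ℂ] W × LinearMap.ker T, ∀ v, (J v).1 = T v := by
  obtain ⟨K', hK'⟩ := Submodule.exists_isCompl (LinearMap.ker T)
  refine ⟨LinearMap.equivProdOfSurjectiveOfIsCompl T
    ((LinearMap.ker T).projectionOnto K' hK') (LinearMap.range_eq_top.2 hT)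
    (Submodule.range_projectionOnto hK') (by rwa [Submodule.ker_projectionOnto]), fun v => rfl⟩

/-! ### Adapted charts -/

section Adapted

variable {X Y Z : SchemeOver ℂ} {n m : ℕ} [LocallyOfFiniteType X.hom] [SmoothOfRelativeDimension n X.hom]
  [LocallyOfFiniteType Y.hom] [SmoothOfRelativeDimension m Y.hom]

attribute [local instance] ComplexPoints.chartedSpace

omit [LocallyOfFiniteType X.hom] in
/-- Values at a complex point `P ∈ U(ℂ)` and germs at `P.pt`: `s(P) = 0` iff the germ of `s` lies
in the maximal ideal of `𝒪_{X,P}`. [folklore] -/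
theorem eval_eq_zero_iff_germ_mem_maximalIdeal (P : ComplexPoints X) {U : X.left.Opens}
    (hPU : P.pt ∈ U) (s : Γ(X.left, U)) :
    P.eval U hPU s = 0 ↔
      (X.left.presheaf.germ U P.pt hPU).hom s ∈ IsLocalRing.maximalIdeal (X.left.presheaf.stalk P.pt) := by
  rw [IsLocalRing.mem_maximalIdeal, mem_nonunits_iff, ← Scheme.mem_basicOpen,
    AlgPoints.pt_mem_basicOpen_iff P hPU, not_not]

-- calculus on the model vector spaces must see through the model-space instances
set_option backward.isDefEq.respectTransparency false in
/-- **Adapted charts.** Let `g : X ⟶ Y` be a morphism of `ℂ`-schemes smooth over `ℂ` (relative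
dimensions `n`, `m`) and locally of finite type, `P ∈ X(ℂ)`; `ι : Z ⟶ X` affine with `P' ∈ Z(ℂ)`
over `P` at which `ι ≫ g` is smooth; `w₁, …, w_r ∈ Γ(X, U₀)` (`U₀ ∋ P` affine) with `ι^* wᵢ = 0`
and germs at `P` linearly independent modulo `𝔪_P²`; `S_j ⊆ X` (`j ∈ κ`, finite) closed subsets,
each missing `P` or equal on `U₀` to the zero set of some `wᵢ`. Then there is an open partial
homeomorphism `φ : X(ℂ) ⇀ ℝ²ᵐ × ℂⁿ⁻ᵐ` with `P ∈ φ.source`, `C^∞` with `C^∞` inverse (for the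
real manifold structures `ComplexPoints.chartedSpace`), with `φ.source` over the chart domain of
`Y(ℂ)` at `g(P)`, first component `extChartAt (g P) ∘ g(ℂ)`, and such that each
`S_j(ℂ) ∩ φ.source` is empty or `φ.source ∩ φ⁻¹(ℝ²ᵐ × L_j)` for a real linear subspace `L_j`.
[cite: VoisinHodgeI2002, §9.1.1] [cite: Dimca1992, Ch. 1 Prop. (3.1)]
[cite: SerreGAGA1956, §2 n°5 Prop. 2] -/
theorem exists_adaptedChart (g : X ⟶ Y) (P : ComplexPoints X)
    (ι : Z ⟶ X) [IsAffineHom ι.left] [LocallyOfFinitePresentation (ι ≫ g).left]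
    (P' : ComplexPoints Z) (hP' : AlgPoints.map ι P' = P)
    (hsm : P'.pt ∈ (ι ≫ g).left.smoothLocus)
    (U₀ : X.left.affineOpens) (hPU₀ : P.pt ∈ (↑U₀ : X.left.Opens)) {r : ℕ}
    (w : Fin r → Γ(X.left, ↑U₀))
    (hwZ : ∀ i, ι.left.appLE ↑U₀ (ι.left ⁻¹ᵁ ↑U₀) le_rfl (w i) = 0)
    (hwind : ∀ b : Fin r → ℂ,
      (X.left.presheaf.germ ↑U₀ P.pt hPU₀).hom (∑ i, SchemeOver.scalarRingHom X ↑U₀ (b i) * w i) ∈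
        IsLocalRing.maximalIdeal (X.left.presheaf.stalk P.pt) ^ 2 → b = 0)
    {κ : Type*} [Finite κ] (S : κ → Set X.left) (hS : ∀ j, IsClosed (S j))
    (hSw : ∀ j, P.pt ∉ S j ∨
      ∃ i, S j ∩ (↑U₀ : Set X.left) = (↑U₀ : Set X.left) \ X.left.basicOpen (w i)) :
    ∃ φ : OpenPartialHomeomorph (ComplexPoints X)
        (EuclideanSpace ℝ (Fin (2 * m)) × (Fin (n - m) → ℂ)),
      P ∈ φ.source ∧
      ContMDiffOn (𝓡 (2 * n)) 𝓘(ℝ, EuclideanSpace ℝ (Fin (2 * m)) × (Fin (n - m) → ℂ)) ∞ φ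
        φ.source ∧
      ContMDiffOn 𝓘(ℝ, EuclideanSpace ℝ (Fin (2 * m)) × (Fin (n - m) → ℂ)) (𝓡 (2 * n)) ∞ φ.symm
        φ.target ∧
      φ.source ⊆ AlgPoints.map g ⁻¹'
        (chartAt (EuclideanSpace ℝ (Fin (2 * m))) (AlgPoints.map g P)).source ∧
      (∀ y ∈ φ.source, (φ y).1 = extChartAt (𝓡 (2 * m)) (AlgPoints.map g P) (AlgPoints.map g y)) ∧
      ∀ j, {R : ComplexPoints X | R.pt ∈ S j} ∩ φ.source = ∅ ∨
        ∃ L : Submodule ℝ (Fin (n - m) → ℂ), {R : ComplexPoints X | R.pt ∈ S j} ∩ φ.source =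
          φ.source ∩ φ ⁻¹' ((⊤ : Submodule ℝ (EuclideanSpace ℝ (Fin (2 * m)))).prod L :
            Set (EuclideanSpace ℝ (Fin (2 * m)) × (Fin (n - m) → ℂ))) := by
  classical
  haveI := ComplexPoints.isManifold_real X n
  haveI := ComplexPoints.isManifold_real Y m
  -- ### the algebraic charts at `P` and `Q = g P`
  set LX := ContinuousLinearEquiv.ofFinrankEq (finrank_real_pi_complex_eq n) with hLX
  set LY := ContinuousLinearEquiv.ofFinrankEq (finrank_real_pi_complex_eq m) with hLY
  set Q := AlgPoints.map g P with hQdef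
  set aX := ComplexPoints.algebraicChart X n P with haX
  set aY := ComplexPoints.algebraicChart Y m Q with haY
  obtain ⟨⟨V₁, u, hsrcY, hu⟩, holY⟩ := ComplexPoints.algebraicChart_spec Y m Q
  obtain ⟨algX, holX⟩ := ComplexPoints.algebraicChart_spec X n P
  have hP : P ∈ aX.source := ComplexPoints.mem_algebraicChart_source X n P
  have hQ : Q ∈ aY.source := ComplexPoints.mem_algebraicChart_source Y m Q
  have hQV₁ : Q.pt ∈ (↑V₁ : Y.left.Opens) := hsrcY hQ
  -- ### local coordinates on an affine open `U ⊆ U₀ ∩ g⁻¹ V₁`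
  obtain ⟨U, hPU, hUle, t, htspan⟩ := exists_localCoordinates_le n P (↑U₀ ⊓ g.left ⁻¹ᵁ ↑V₁)
    ⟨hPU₀, show (AlgPoints.map g P).pt ∈ (↑V₁ : Y.left.Opens) from hQV₁⟩
  have hUU₀ : (↑U : X.left.Opens) ≤ ↑U₀ := hUle.trans inf_le_left
  have hle : (↑U : X.left.Opens) ≤ g.left ⁻¹ᵁ ↑V₁ := hUle.trans inf_le_right
  -- the equations restricted to `U`
  set wU : Fin r → Γ(X.left, ↑U) := fun i => X.left.presheaf.map (homOfLE hUU₀).op (w i) with hwU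
  have hwUZ : ∀ i, ι.left.appLE ↑U (ι.left ⁻¹ᵁ ↑U) le_rfl (wU i) = 0 := by
    intro i
    have h1 : ι.left.appLE ↑U (ι.left ⁻¹ᵁ ↑U) le_rfl (wU i) =
        (X.left.presheaf.map (homOfLE hUU₀).op ≫ ι.left.appLE ↑U (ι.left ⁻¹ᵁ ↑U) le_rfl) (w i) := rfl
    have hleV : ι.left ⁻¹ᵁ ↑U ≤ ι.left ⁻¹ᵁ ↑U₀ := Scheme.Hom.preimage_mono _ hUU₀
    have h2 : ι.left.appLE ↑U₀ (ι.left ⁻¹ᵁ ↑U) hleV (w i) =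
        (ι.left.appLE ↑U₀ (ι.left ⁻¹ᵁ ↑U₀) le_rfl ≫ Z.left.presheaf.map (homOfLE hleV).op) (w i) := by
      rw [Scheme.Hom.appLE_map]
    rw [h1, Scheme.Hom.map_appLE]
    change ι.left.appLE ↑U₀ (ι.left ⁻¹ᵁ ↑U) hleV (w i) = 0
    rw [h2, CommRingCat.comp_apply, hwZ i, map_zero]
  have hwUind : ∀ b : Fin r → ℂ, ∑ i, SchemeOver.scalarRingHom X ↑U (b i) * wU i ∈
      RingHom.ker (P.evalRingHom ↑U hPU) ^ 2 → b = 0 := by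
    intro b hb
    refine hwind b ?_
    -- `∑ bᵢ wᵢ|_U` is the restriction of `∑ bᵢ wᵢ`
    set res := (X.left.presheaf.map (homOfLE hUU₀).op).hom with hres
    have hscal : ∀ c : ℂ, SchemeOver.scalarRingHom X ↑U c = res (SchemeOver.scalarRingHom X ↑U₀ c) := by
      intro c
      rw [SchemeOver.scalarRingHom_apply, SchemeOver.scalarRingHom_apply, hres]
      change _ = (X.hom.appLE ⊤ ↑U₀ le_top ≫ X.left.presheaf.map (homOfLE hUU₀).op) _
      rw [Scheme.Hom.appLE_map]
    have hsum : ∑ i, SchemeOver.scalarRingHom X ↑U (b i) * wU i =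
        res (∑ i, SchemeOver.scalarRingHom X ↑U₀ (b i) * w i) := by
      rw [map_sum]
      refine Finset.sum_congr rfl fun i _ => ?_
      rw [map_mul, hscal]
    -- germs: `(ker eval_P)² ↦ 𝔪_P²`
    have hker : RingHom.ker (P.evalRingHom ↑U hPU) ≤
        (IsLocalRing.maximalIdeal (X.left.presheaf.stalk P.pt)).comap
          (X.left.presheaf.germ ↑U P.pt hPU).hom := fun s hs => by
      rw [Ideal.mem_comap, ← eval_eq_zero_iff_germ_mem_maximalIdeal P hPU s]
      exact hs
    have hker2 := (Ideal.pow_right_mono hker 2).trans (Ideal.le_comap_pow _ 2)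
    have hmem := hker2 hb
    rw [Ideal.mem_comap, hsum, hres] at hmem
    rwa [TopCat.Presheaf.germ_res_apply' X.left.presheaf] at hmem
  -- ### the relative submersion at `P`
  obtain ⟨hdiffG, hdiffW, hsurjT⟩ := surjective_fderiv_chart_map_prod g aX hP holX algX aY hQ holY
    V₁ u hsrcY hu U hPU hle t htspan ι P' hP' hsm wU hwUZ hwUind
  -- the holomorphic maps read in the chart
  set Gm : (Fin n → ℂ) → (Fin m → ℂ) := aY ∘ AlgPoints.map g ∘ aX.symm with hGm
  set Wf : Fin r → (Fin n → ℂ) → ℂ := fun i => evalOrZero ↑U (wU i) ∘ aX.symm with hWf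
  set z₀ : Fin n → ℂ := aX P with hz₀
  -- ### linear algebra: complete the differential of `(G, W)` to an isomorphism
  set T : (Fin n → ℂ) →L[ℂ] (Fin m → ℂ) × (Fin r → ℂ) :=
    (fderiv ℂ Gm z₀).prod (ContinuousLinearMap.pi fun i => fderiv ℂ (Wf i) z₀) with hT
  let Tl : (Fin n → ℂ) →ₗ[ℂ] (Fin m → ℂ) × (Fin r → ℂ) := (T : (Fin n → ℂ) →ₗ[ℂ] (Fin m → ℂ) × (Fin r → ℂ))
  have hTl : ∀ v, Tl v = T v := fun v => rfl
  have hTsurj : Function.Surjective Tl := by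
    intro y
    obtain ⟨ξ, hξ⟩ := hsurjT y
    exact ⟨ξ, hξ⟩
  obtain ⟨J, hJ⟩ := exists_linearEquiv_prod_ker_fst_eq Tl hTsurj
  -- dimension count: `r + dim ker T = n - m`
  have hdimK : Module.finrank ℂ ((Fin r → ℂ) × LinearMap.ker Tl) =
      Module.finrank ℂ (Fin (n - m) → ℂ) := by
    have h1 := LinearMap.finrank_range_add_finrank_ker Tl
    rw [LinearMap.range_eq_top.2 hTsurj, finrank_top] at h1
    simp only [Module.finrank_prod, Module.finrank_fin_fun] at h1 ⊢
    omega
  set eqv : ((Fin r → ℂ) × LinearMap.ker Tl) ≃ₗ[ℂ] (Fin (n - m) → ℂ) :=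
    LinearEquiv.ofFinrankEq _ _ hdimK with heqv
  -- the straightening map in the chart and its derivative at `z₀`
  let pK : (Fin n → ℂ) →ₗ[ℂ] LinearMap.ker Tl :=
    { toFun := fun v => (J v).2
      map_add' := fun v v' => by simp
      map_smul' := fun c v => by simp }
  have hpK : ∀ v, pK v = (J v).2 := fun v => rfl
  set Θ : (Fin n → ℂ) → EuclideanSpace ℝ (Fin (2 * m)) × (Fin (n - m) → ℂ) :=
    fun z => (LY (Gm z), eqv (fun i => Wf i z, pK z)) with hΘ
  -- the real-linear isomorphism `ℂⁿ ≃ ℝ²ᵐ × ℂⁿ⁻ᵐ` which is the derivative of `Θ` at `z₀`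
  set Jfull : (Fin n → ℂ) ≃ₗ[ℂ] (Fin m → ℂ) × (Fin (n - m) → ℂ) :=
    J.trans ((LinearEquiv.prodAssoc ℂ (Fin m → ℂ) (Fin r → ℂ) (LinearMap.ker Tl)).trans
      (LinearEquiv.prodCongr (LinearEquiv.refl ℂ _) eqv)) with hJfull
  have hJfull_apply : ∀ v, Jfull v = ((T v).1, eqv ((T v).2, pK v)) := by
    intro v
    have h1 : (J v).1 = T v := hJ v
    simp only [hJfull, LinearEquiv.trans_apply, LinearEquiv.prodCongr_apply,
      LinearEquiv.refl_apply, hpK]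
    rw [show J v = ((J v).1, (J v).2) from rfl, h1]
    rfl
  set Tre : (Fin n → ℂ) ≃L[ℝ] EuclideanSpace ℝ (Fin (2 * m)) × (Fin (n - m) → ℂ) :=
    (Jfull.restrictScalars ℝ).toContinuousLinearEquiv.trans
      (LY.prodCongr (ContinuousLinearEquiv.refl ℝ (Fin (n - m) → ℂ))) with hTre
  have hTre_apply : ∀ v, Tre v = (LY (T v).1, eqv ((T v).2, pK v)) := by
    intro v
    change (LY.prodCongr (ContinuousLinearEquiv.refl ℝ (Fin (n - m) → ℂ))) (Jfull v) = _
    rw [hJfull_apply]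
    rfl
  -- ### smoothness of `Θ` near `z₀` and its derivative
  set O : Set (Fin n → ℂ) := aX.target ∩ aX.symm ⁻¹' (AlgPoints.map g ⁻¹' aY.source) ∩
    aX.symm ⁻¹' {R | R.pt ∈ (↑U : X.left.Opens)} with hO
  have hOopen : IsOpen O := by
    have h1 : IsOpen (aX.target ∩ aX.symm ⁻¹' (AlgPoints.map g ⁻¹' aY.source)) :=
      aX.isOpen_inter_preimage_symm (aY.open_source.preimage (AlgPoints.continuous_map g))
    have h2 : IsOpen (aX.target ∩ aX.symm ⁻¹' {R : ComplexPoints X | R.pt ∈ (↑U : X.left.Opens)}) :=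
      aX.isOpen_inter_preimage_symm (AlgPoints.isOpen_setOf_pt_mem _)
    have : O = (aX.target ∩ aX.symm ⁻¹' (AlgPoints.map g ⁻¹' aY.source)) ∩
        (aX.target ∩ aX.symm ⁻¹' {R : ComplexPoints X | R.pt ∈ (↑U : X.left.Opens)}) := by
      rw [hO]; ext z; simp only [mem_inter_iff, mem_preimage]; tauto
    rw [this]
    exact h1.inter h2
  have hz₀O : z₀ ∈ O := by
    refine ⟨⟨aX.map_source hP, ?_⟩, ?_⟩
    · rw [mem_preimage, hz₀, aX.left_inv hP]; exact hQ
    · rw [mem_preimage, hz₀, aX.left_inv hP]; exact hPU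
  have hGmO : ContDiffOn ℝ ∞ Gm (aX.target ∩ aX.symm ⁻¹' (AlgPoints.map g ⁻¹' aY.source)) :=
    ((ComplexPoints.contDiffOn_chart_map (n := n) (m := m) g P Q).restrict_scalars ℝ).of_le le_top
  have hWfO : ∀ i, ContDiffOn ℝ ∞ (Wf i)
      (aX.target ∩ aX.symm ⁻¹' {R : ComplexPoints X | R.pt ∈ (↑U : X.left.Opens)}) := fun i =>
    ((holX U (wU i)).restrict_scalars ℝ).of_le le_top
  have hΘO : ContDiffOn ℝ ∞ Θ O := by
    refine ContDiffOn.prodMk ?_ ?_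
    · exact LY.contDiff.comp_contDiffOn (hGmO.mono fun z hz => hz.1)
    · refine ((eqv.restrictScalars ℝ).toContinuousLinearEquiv.contDiff).comp_contDiffOn ?_
      refine ContDiffOn.prodMk ?_ ?_
      · exact contDiffOn_pi.2 fun i => (hWfO i).mono fun z hz => ⟨hz.1.1, hz.2⟩
      · exact ((pK.restrictScalars ℝ).toContinuousLinearMap.contDiff).contDiffOn
  have hΘderiv : HasFDerivAt Θ (Tre : (Fin n → ℂ) →L[ℝ] _) z₀ := by
    have hG' : HasFDerivAt Gm ((fderiv ℂ Gm z₀).restrictScalars ℝ) z₀ :=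
      hdiffG.hasFDerivAt.restrictScalars ℝ
    have hW' : ∀ i, HasFDerivAt (Wf i) ((fderiv ℂ (Wf i) z₀).restrictScalars ℝ) z₀ := fun i =>
      (hdiffW i).hasFDerivAt.restrictScalars ℝ
    have hWv : HasFDerivAt (fun z i => Wf i z)
        (ContinuousLinearMap.pi fun i => (fderiv ℂ (Wf i) z₀).restrictScalars ℝ) z₀ :=
      hasFDerivAt_pi.2 hW'
    have hpK' : HasFDerivAt (fun z => pK z) (pK.restrictScalars ℝ).toContinuousLinearMap z₀ :=
      (pK.restrictScalars ℝ).toContinuousLinearMap.hasFDerivAt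
    have h2 := ((eqv.restrictScalars ℝ).toContinuousLinearEquiv).hasFDerivAt.comp z₀ (hWv.prodMk hpK')
    have h1 := LY.hasFDerivAt.comp z₀ hG'
    have h := h1.prodMk h2
    refine h.congr_fderiv ?_
    ext1 v
    rw [ContinuousLinearEquiv.coe_coe, hTre_apply]
    rfl
  -- ### the inverse function theorem
  obtain ⟨Gh, hGhΘ, hz₀Gh, hGhO, hGhs, hGhsymm⟩ :=
    exists_openPartialHomeomorph_contDiffOn_symm' hOopen hz₀O (m := ∞) (by norm_cast) hΘO Tre hΘderiv
  -- ### the chart: `aX` followed by `Gh`, away from the `S j` not through `P`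
  set Ω : Set (ComplexPoints X) := ⋂ j ∈ {j | P.pt ∉ S j}, {R | R.pt ∉ S j} with hΩ
  have hΩopen : IsOpen Ω := by
    refine Set.Finite.isOpen_biInter (Set.toFinite _) fun j _ => ?_
    exact AlgPoints.isOpen_setOf_pt_mem ⟨(S j)ᶜ, (hS j).isOpen_compl⟩
  have hPΩ : P ∈ Ω := by
    simp only [hΩ, mem_iInter, mem_setOf_eq]
    exact fun j hj => hj
  set φ : OpenPartialHomeomorph (ComplexPoints X)
      (EuclideanSpace ℝ (Fin (2 * m)) × (Fin (n - m) → ℂ)) := (aX.trans Gh).restrOpen Ω hΩopen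
    with hφdef
  have hφapply : ∀ y, φ y = Θ (aX y) := fun y => by
    rw [hφdef, OpenPartialHomeomorph.coe_restrOpen, OpenPartialHomeomorph.coe_trans,
      Function.comp_apply, hGhΘ]
  have hφsource : φ.source = (aX.source ∩ aX ⁻¹' Gh.source) ∩ Ω := by
    rw [hφdef, OpenPartialHomeomorph.restrOpen_source, OpenPartialHomeomorph.trans_source]
  have hφsymm : ∀ b, φ.symm b = aX.symm (Gh.symm b) := fun b => rfl
  -- points of the source: in `aX.source`, over `U`, over `aY.source`
  have hsrc_aX : ∀ y ∈ φ.source, y ∈ aX.source := fun y hy => by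
    rw [hφsource] at hy; exact hy.1.1
  have hsrc_O : ∀ y ∈ φ.source, aX y ∈ O := fun y hy => by
    rw [hφsource] at hy; exact hGhO hy.1.2
  have hsrc_U : ∀ y ∈ φ.source, y.pt ∈ (↑U : X.left.Opens) := fun y hy => by
    have h := (hsrc_O y hy).2
    rwa [mem_preimage, aX.left_inv (hsrc_aX y hy)] at h
  have hsrc_Y : ∀ y ∈ φ.source, AlgPoints.map g y ∈ aY.source := fun y hy => by
    have h := (hsrc_O y hy).1.2
    rwa [mem_preimage, aX.left_inv (hsrc_aX y hy)] at h
  refine ⟨φ, ?_, ?_, ?_, ?_, ?_, ?_⟩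
  · -- `P ∈ φ.source`
    rw [hφsource]
    exact ⟨⟨hP, hz₀Gh⟩, hPΩ⟩
  · -- `φ` is `C^∞`: read in the chart `aX` it is `Gh`
    rw [contMDiffOn_iff_of_subset_source' (x := P) (y := (0 : EuclideanSpace ℝ (Fin (2 * m)) ×
      (Fin (n - m) → ℂ))) (by
        rw [extChartAt_source, ComplexPoints.chartAt_eq, OpenPartialHomeomorph.transHomeomorph_source]
        exact hsrc_aX) (by
        rw [extChartAt_source]; exact fun _ _ => by simp)]
    have hfun : ∀ z ∈ (extChartAt (𝓡 (2 * n)) P) '' φ.source,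
        (extChartAt 𝓘(ℝ, EuclideanSpace ℝ (Fin (2 * m)) × (Fin (n - m) → ℂ)) 0 ∘ φ ∘
          (extChartAt (𝓡 (2 * n)) P).symm) z = Gh (LX.symm z) := by
      rintro _ ⟨y, hy, rfl⟩
      simp only [Function.comp_apply, extChartAt_model_space_eq_id, PartialEquiv.refl_coe, id_eq]
      change φ (aX.symm (LX.symm (LX (aX y)))) = Gh (LX.symm (LX (aX y)))
      rw [LX.symm_apply_apply, aX.left_inv (hsrc_aX y hy), hφapply, hGhΘ]
    refine ContDiffOn.congr (f := fun z => Gh (LX.symm z)) ?_ hfun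
    have himg : (extChartAt (𝓡 (2 * n)) P) '' φ.source ⊆ LX.symm ⁻¹' Gh.source := by
      rintro _ ⟨y, hy, rfl⟩
      change LX.symm (LX (aX y)) ∈ Gh.source
      rw [LX.symm_apply_apply]
      rw [hφsource] at hy
      exact hy.1.2
    exact (hGhs.comp LX.symm.contDiff.contDiffOn fun z hz => hz).mono himg
  · -- `φ⁻¹` is `C^∞`: read in the chart `aX` it is `Gh⁻¹`
    rw [contMDiffOn_iff_of_subset_source' (x := (0 : EuclideanSpace ℝ (Fin (2 * m)) ×
      (Fin (n - m) → ℂ))) (y := P) (by rw [extChartAt_source]; exact fun _ _ => by simp)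
      (by
        rw [extChartAt_source, ComplexPoints.chartAt_eq, OpenPartialHomeomorph.transHomeomorph_source]
        exact fun b hb => hsrc_aX _ (φ.map_target hb))]
    have hset : (extChartAt 𝓘(ℝ, EuclideanSpace ℝ (Fin (2 * m)) × (Fin (n - m) → ℂ)) 0) '' φ.target =
        φ.target := by
      rw [extChartAt_model_space_eq_id, PartialEquiv.refl_coe, image_id]
    rw [hset]
    have hfun : ∀ b ∈ φ.target,
        (extChartAt (𝓡 (2 * n)) P ∘ φ.symm ∘
          (extChartAt 𝓘(ℝ, EuclideanSpace ℝ (Fin (2 * m)) × (Fin (n - m) → ℂ)) 0).symm) b =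
          LX (Gh.symm b) := by
      intro b hb
      simp only [Function.comp_apply, extChartAt_model_space_eq_id, PartialEquiv.refl_symm,
        PartialEquiv.refl_coe, id_eq]
      change LX (aX (φ.symm b)) = LX (Gh.symm b)
      rw [hφsymm, aX.right_inv]
      have hb1 : b ∈ (aX.trans Gh).target := hb.1
      rw [OpenPartialHomeomorph.trans_target] at hb1
      exact (hGhO (Gh.map_target hb1.1)).1.1
    refine ContDiffOn.congr (f := fun b => LX (Gh.symm b)) ?_ hfun
    have htgt : φ.target ⊆ Gh.target := by
      intro b hb
      have hb1 : b ∈ (aX.trans Gh).target := hb.1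
      rw [OpenPartialHomeomorph.trans_target] at hb1
      exact hb1.1
    exact (LX.contDiff.comp_contDiffOn hGhsymm).mono htgt
  · -- the source lies over the chart domain of `Y(ℂ)` at `Q`
    intro y hy
    rw [mem_preimage, ComplexPoints.chartAt_eq, OpenPartialHomeomorph.transHomeomorph_source]
    exact hsrc_Y y hy
  · -- first component `= extChartAt Q ∘ g(ℂ)`
    intro y hy
    rw [hφapply]
    change LY (aY (AlgPoints.map g (aX.symm (aX y)))) = LY (aY (AlgPoints.map g y))
    rw [aX.left_inv (hsrc_aX y hy)]
  · -- straightening of the `S j`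
    intro j
    rcases hSw j with hj | ⟨i, hi⟩
    · left
      ext y
      simp only [mem_inter_iff, mem_setOf_eq, mem_empty_iff_false, iff_false, not_and]
      intro hyS hy
      rw [hφsource] at hy
      have h := hy.2
      simp only [hΩ, mem_iInter, mem_setOf_eq] at h
      exact h j hj hyS
    · right
      -- `L = eqv (ker prᵢ × K)`
      let p : Submodule ℂ ((Fin r → ℂ) × LinearMap.ker Tl) :=
        (LinearMap.ker (LinearMap.proj i : (Fin r → ℂ) →ₗ[ℂ] ℂ)).prod ⊤
      refine ⟨(p.map (eqv : ((Fin r → ℂ) × LinearMap.ker Tl) →ₗ[ℂ] (Fin (n - m) → ℂ))).restrictScalars ℝ,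
        ?_⟩
      ext y
      simp only [mem_inter_iff, mem_setOf_eq, mem_preimage, SetLike.mem_coe, Submodule.mem_prod,
        Submodule.mem_top, true_and, Submodule.restrictScalars_mem]
      constructor
      · rintro ⟨hyS, hy⟩
        refine ⟨hy, ?_⟩
        rw [hφapply]
        change eqv (fun i => Wf i (aX y), pK (aX y)) ∈
          p.map (eqv : ((Fin r → ℂ) × LinearMap.ker Tl) →ₗ[ℂ] _)
        rw [Submodule.mem_map_equiv, LinearEquiv.symm_apply_apply]
        refine ⟨?_, Submodule.mem_top⟩
        -- `wᵢ(y) = 0` since `y.pt ∈ S j ∩ U₀ ⊆ X ∖ D(wᵢ)`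
        change (fun i => Wf i (aX y)) i = 0
        have hyU : y.pt ∈ (↑U : X.left.Opens) := hsrc_U y hy
        have hyU₀ : y.pt ∈ (↑U₀ : X.left.Opens) := hUU₀ hyU
        have hnot : y.pt ∉ X.left.basicOpen (w i) := by
          have h : y.pt ∈ S j ∩ (↑U₀ : Set X.left) := ⟨hyS, hyU₀⟩
          rw [hi] at h
          exact h.2
        simp only [hWf, Function.comp_apply]
        rw [aX.left_inv (hsrc_aX y hy), evalOrZero_of_mem _ hyU, hwU,
          AlgPoints.eval_map_homOfLE hUU₀ (w i) hyU]
        by_contra hne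
        exact hnot ((AlgPoints.pt_mem_basicOpen_iff y hyU₀ (w i)).2 hne)
      · rintro ⟨hy, hmem⟩
        refine ⟨?_, hy⟩
        rw [hφapply] at hmem
        change eqv (fun i => Wf i (aX y), pK (aX y)) ∈
          p.map (eqv : ((Fin r → ℂ) × LinearMap.ker Tl) →ₗ[ℂ] _) at hmem
        rw [Submodule.mem_map_equiv, LinearEquiv.symm_apply_apply] at hmem
        have h0 : Wf i (aX y) = 0 := hmem.1
        have hyU : y.pt ∈ (↑U : X.left.Opens) := hsrc_U y hy
        have hyU₀ : y.pt ∈ (↑U₀ : X.left.Opens) := hUU₀ hyU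
        simp only [hWf, Function.comp_apply] at h0
        rw [aX.left_inv (hsrc_aX y hy), evalOrZero_of_mem _ hyU, hwU,
          AlgPoints.eval_map_homOfLE hUU₀ (w i) hyU] at h0
        have hnot : y.pt ∉ X.left.basicOpen (w i) := fun hmemD =>
          (AlgPoints.pt_mem_basicOpen_iff y hyU₀ (w i)).1 hmemD h0
        have h : y.pt ∈ (↑U₀ : Set X.left) \ X.left.basicOpen (w i) := ⟨hyU₀, hnot⟩
        rw [← hi] at h
        exact h.1

end Adapted

end Literature.AlgebraicGeometry.Motives

end
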